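import Mathlib
import Literature.Analysis.FluidPDE.Tao2016AveragedNS.ShiftSetCascadeFlows
import Summits.NavierStokesRegularity.NavierStokesRegularity.Theorems.TaoLadderRungTwoFlatCertificateGlueCheckerTableOn
import Summits.NavierStokesRegularity.NavierStokesRegularity.Theorems.TaoLadderRungTwoFlatCertificateGlueTruncFlowPerCompOn
import HarnessLib

/-!
# Certificate glue on a shift set `𝕊`, XXV-h: ROW CONSTANTS of the window field — the per-row bilinear bound
  `|PQcN y z|_c ≤ (rowTabR_c / ω_c)·‖y‖‖z‖` and its dyadic majorant from the coefficient boxes, `|PQcN y y|_c ≤ bRowSum_c · N²`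
  (the hypothesis `hBrow` of glue XIX-g `stepCert_of_plohner_box`) (helper for items stmt-NavierStokesRegularity-22987
  `FlatGapCertificatesV2` (crux K_A♭ of route TaoLadderRungTwoFlat) and stmt-24295 K_A₂(64); cell harvest/h2-tao-ladder, p1 g15)

HONEST FRAMING: Tao-type MODEL lattices (Tao 2016 §4/§6 vocabulary, shift-set parametrised); arithmetic soundness lemmas — no certificate data,
nothing certified, no stub closed, nothing about the Navier–Stokes equations.
-/

-- the sub-problem namespace repeats the summit name by design (D-0017)
set_option linter.dupNamespace false

namespace Summit.NavierStokesRegularity.NavierStokesRegularity.Theorems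

open Set Finset Literature.Analysis.FluidPDE Literature.Analysis.FluidPDE.TaoCascade
open Summit.NavierStokesRegularity.NavierStokesRegularity.Theorems.TaylorModelCert

namespace CertificateGlueOn

variable {m : ℕ} {Kb Ka : ℤ} {ω : Fin m → ℤ → ℝ} {𝕊 : Finset (ℤ × ℤ × ℤ)} {ε₀ : ℝ} {α : Fin m → Fin m → Fin m → ℤ × ℤ × ℤ → ℝ}

/-- The real (B)-row table `Σ_{i₁ i₂ μ} |α| (1+ε₀)^{5(k−μ₃)/2} ω̂_{i₁}(a) ω̂_{i₂}(b)` at target `(i, k)`. [folklore] -/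
noncomputable def rowTabR (𝕊 : Finset (ℤ × ℤ × ℤ)) (ε₀ : ℝ) (α : Fin m → Fin m → Fin m → ℤ × ℤ × ℤ → ℝ) (Kb Ka : ℤ)
    (ω : Fin m → ℤ → ℝ) (i : Fin m) (k : ℤ) : ℝ :=
  ∑ i₁ : Fin m, ∑ i₂ : Fin m, ∑ μ ∈ 𝕊,
    |α i₁ i₂ i μ| * (1 + ε₀) ^ ((5 : ℝ) * (k - μ.2.2) / 2) *
      (pwExt Kb Ka ω i₁ (k - μ.2.2 + μ.1) * pwExt Kb Ka ω i₂ (k - μ.2.2 + μ.2.1))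

/-- **Per-row bilinear bound** (row version of glue XVI-c `pqc_bound_of_table`): for `|y| ≤ Ny`, `|z| ≤ Nz` and the coordinate `d ↔ (i,k)`,
`|PQcN y z|_d · ω i k ≤ rowTabR i k · Ny · Nz`. [folklore] -/
theorem pqcN_row_bound (hε : 0 < 1 + ε₀) (hω : ∀ i k, 0 < ω i k) (hKK : 0 ≤ Ka + Kb + 1) (y z : Fin (m * winLen Kb Ka) → ℝ)
    {Ny Nz : ℝ} (hNy : 0 ≤ Ny) (hy : ∀ d, |y d| ≤ Ny) (hz : ∀ d, |z d| ≤ Nz) (d : Fin (m * winLen Kb Ka)) :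
    |PQcN 𝕊 ε₀ α Kb Ka ω y z d| * ω (finProdFinEquiv.symm d).1 (shellAt Kb (finProdFinEquiv.symm d).2) ≤
      rowTabR 𝕊 ε₀ α Kb Ka ω (finProdFinEquiv.symm d).1 (shellAt Kb (finProdFinEquiv.symm d).2) * Ny * Nz := by
  set c := finProdFinEquiv.symm d with hc
  set k := shellAt Kb c.2 with hk
  have hxw : ∀ e, |(y ∘ finProdFinEquiv) e| ≤ Ny := fun e => hy _
  have hzw : ∀ e, |(z ∘ finProdFinEquiv) e| ≤ Nz := fun e => hz _
  have hval : PQcN 𝕊 ε₀ α Kb Ka ω y z d =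
      biFieldOn 𝕊 ε₀ α Kb Ka (pwstate Kb Ka ω (y ∘ finProdFinEquiv)) (pwstate Kb Ka ω (z ∘ finProdFinEquiv)) c.1 k / ω c.1 k := by
    simp only [PQcN, PQc, pwcoord, ← hc, ← hk]
  rw [hval, abs_div, abs_of_pos (hω c.1 k), div_mul_cancel₀ _ (hω c.1 k).ne']
  unfold biFieldOn rowTabR
  refine (Finset.abs_sum_le_sum_abs _ _).trans ?_
  rw [Finset.sum_mul, Finset.sum_mul]
  refine Finset.sum_le_sum fun i₁ _ => ?_
  refine (Finset.abs_sum_le_sum_abs _ _).trans ?_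
  rw [Finset.sum_mul, Finset.sum_mul]
  refine Finset.sum_le_sum fun i₂ _ => ?_
  refine (Finset.abs_sum_le_sum_abs _ _).trans ?_
  rw [Finset.sum_mul, Finset.sum_mul]
  refine Finset.sum_le_sum fun μ _ => ?_
  have hc0 : 0 ≤ (1 + ε₀) ^ ((5 : ℝ) * (k - μ.2.2) / 2) := (Real.rpow_pos_of_pos hε _).le
  have ha := abs_truncAt_pwstate_le hω hKK hxw i₁ (k - μ.2.2 + μ.1)
  have hb := abs_truncAt_pwstate_le hω hKK hzw i₂ (k - μ.2.2 + μ.2.1)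
  rw [abs_mul, abs_mul, abs_mul, abs_of_nonneg hc0]
  have hw1 : 0 ≤ pwExt Kb Ka ω i₁ (k - μ.2.2 + μ.1) := pwExt_nonneg (fun i k => (hω i k).le) _ _
  calc |α i₁ i₂ c.1 μ| * (1 + ε₀) ^ ((5 : ℝ) * (k - μ.2.2) / 2) *
        (|truncAt Kb Ka (pwstate Kb Ka ω (y ∘ finProdFinEquiv)) i₁ (k - μ.2.2 + μ.1)| *
          |truncAt Kb Ka (pwstate Kb Ka ω (z ∘ finProdFinEquiv)) i₂ (k - μ.2.2 + μ.2.1)|)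
      ≤ |α i₁ i₂ c.1 μ| * (1 + ε₀) ^ ((5 : ℝ) * (k - μ.2.2) / 2) *
        ((Ny * pwExt Kb Ka ω i₁ (k - μ.2.2 + μ.1)) * (Nz * pwExt Kb Ka ω i₂ (k - μ.2.2 + μ.2.1))) :=
        mul_le_mul_of_nonneg_left (mul_le_mul ha hb (abs_nonneg _) (mul_nonneg hNy hw1)) (mul_nonneg (abs_nonneg _) hc0)
    _ = |α i₁ i₂ c.1 μ| * (1 + ε₀) ^ ((5 : ℝ) * (k - μ.2.2) / 2) *
        (pwExt Kb Ka ω i₁ (k - μ.2.2 + μ.1) * pwExt Kb Ka ω i₂ (k - μ.2.2 + μ.2.1)) * Ny * Nz := by ring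

/-- The real row table is bounded by `ω i k · bRowSum` (coefficient-box magnitudes, glue XXV-e). [folklore] -/
theorem rowTabR_le_bRowSum {shifts : List (ℤ × ℤ × ℤ)} {coefB : Fin m → ℤ → Fin m → Fin m → ℤ × ℤ × ℤ → IntervalD}
    (hω : ∀ i k, 0 < ω i k) (hε : 0 < 1 + ε₀) (hnd : shifts.Nodup) (hcoef : CoefBoxOK shifts ε₀ α Kb Ka ω coefB)
    (i : Fin m) {k : ℤ} (hk1 : -Kb ≤ k) (hk2 : k ≤ Ka) :
    rowTabR shifts.toFinset ε₀ α Kb Ka ω i k ≤ ω i k * (bRowSum Kb Ka shifts coefB i k).toReal := by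
  unfold rowTabR
  rw [toReal_bRowSum hnd, Finset.mul_sum]
  refine Finset.sum_le_sum fun i₁ _ => ?_
  rw [Finset.mul_sum]
  refine Finset.sum_le_sum fun i₂ _ => ?_
  rw [Finset.mul_sum]
  exact Finset.sum_le_sum fun μ hμ => bterm_le hω hcoef hε i hk1 hk2 i₁ i₂ (List.mem_toFinset.mp hμ)

/-- **Row constants from the coefficient boxes**: `|PQcN y y|_d ≤ bRowSum_{(i,k)} · N²` for `|y| ≤ N` — the hypothesis `hBrow` of glue XIX-g
with `brow d := (bRowSum … (i,k)).toReal`, `d ↔ (i,k)`. [folklore] -/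
theorem hBrow_of_coefBox {shifts : List (ℤ × ℤ × ℤ)} {coefB : Fin m → ℤ → Fin m → Fin m → ℤ × ℤ × ℤ → IntervalD}
    (hKb : 0 ≤ Kb) (hKa : 1 ≤ Ka) (hω : ∀ i k, 0 < ω i k) (hε : 0 < 1 + ε₀) (hnd : shifts.Nodup)
    (hcoef : CoefBoxOK shifts ε₀ α Kb Ka ω coefB) :
    ∀ (y : Fin (m * winLen Kb Ka) → ℝ) (N : ℝ), 0 ≤ N → (∀ d, |y d| ≤ N) → ∀ d,
      |PQcN shifts.toFinset ε₀ α Kb Ka ω y y d| ≤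
        (bRowSum Kb Ka shifts coefB (finProdFinEquiv.symm d).1 (shellAt Kb (finProdFinEquiv.symm d).2)).toReal * N ^ 2 := by
  intro y N hN hy d
  have hKK : 0 ≤ Ka + Kb + 1 := by omega
  obtain ⟨hk1, hk2⟩ := shellAt_mem hKK (finProdFinEquiv.symm d).2
  have hrow := pqcN_row_bound (𝕊 := shifts.toFinset) (ε₀ := ε₀) (α := α) hε hω hKK y y hN hy hy d
  have htab := rowTabR_le_bRowSum (ε₀ := ε₀) (α := α) hω hε hnd hcoef (finProdFinEquiv.symm d).1 hk1 hk2
  have hωk := hω (finProdFinEquiv.symm d).1 (shellAt Kb (finProdFinEquiv.symm d).2)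
  set W := ω (finProdFinEquiv.symm d).1 (shellAt Kb (finProdFinEquiv.symm d).2)
  set B := (bRowSum Kb Ka shifts coefB (finProdFinEquiv.symm d).1 (shellAt Kb (finProdFinEquiv.symm d).2)).toReal
  set P := |PQcN shifts.toFinset ε₀ α Kb Ka ω y y d|
  have h1 : P * W ≤ W * B * N * N := by
    calc P * W ≤ rowTabR shifts.toFinset ε₀ α Kb Ka ω (finProdFinEquiv.symm d).1 (shellAt Kb (finProdFinEquiv.symm d).2) * N * N := hrow
      _ ≤ W * B * N * N := by
          have hNN : 0 ≤ N * N := mul_nonneg hN hN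
          nlinarith [htab, hNN]
  have h2 : P ≤ B * N * N := by
    by_contra hcon
    push Not at hcon
    have : W * (B * N * N) < W * P := mul_lt_mul_of_pos_left hcon hωk
    nlinarith [h1, this]
  calc P ≤ B * N * N := h2
    _ = B * N ^ 2 := by ring

end CertificateGlueOn

end Summit.NavierStokesRegularity.NavierStokesRegularity.Theorems
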